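import Summits.Ventures.CertifiedManyBodySolver.Downfold.EmeryBoxesYBCO65planeY6K26ThermalCapRetiltMarkovBoxp1
import Summits.Ventures.CertifiedManyBodySolver.Downfold.EmeryBoxesYBCO65planeY6K26ThermalFloorAtlasWord
import Summits.Ventures.CertifiedManyBodySolver.Downfold.EmeryThermalAtomicFloor
import HarnessLib

/-!
# HIGH-TEMPERATURE-CLOSING `T > 0` WINDOW on YBa2Cu3O6.50 ortho-II (#177 = VSET-v2 #63 M63) plane Cu(2), sites Cu-plane-F AND Cu-plane- — `emeryBoxYBCO65planeY6K26` (router/EMERY-FLOOR-ORDERS row 35): the ATOMIC-LIMIT floor (full entropy) ∨ the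
# family floor, against the re-tilted cap — both sides meet at `6 log 2` as β → 0

Venture CertifiedManyBodySolver, cell `pub/hubbard-downfold` (S1 = ROUTER) × crew hubbard-fast S2 (ii) × (iv) «T > 0 × multi-band» (D-0096 (ii)); seat hubbard-downfold-mod-4
(S1/S2 Emery seam, g17). Namespace `Summit.Ventures.CertifiedManyBodySolver.Downfold`. DOOR: `EmeryThermalAtomicFloor` (`holdsOn_emeryCellPressureAtomicFloor`: Peierls on the
whole occupation basis of the `Cu₄O₈` block, site-wise factorisation; the one-site function is the tree's `atomicPartitionFnReal β U μ`). INPUTS BY NAME: the family floor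
`emeryBoxYBCO65planeY6K26_pressureFloorFam_m9` (`EmeryBoxesYBCO65planeY6K26ThermalFloorAtlasWord`; C = (-136.425965, -136.686364)), the cap `emeryBoxYBCO65planeY6K26_pressureCap_m9_retilt` (`EmeryBoxesYBCO65planeY6K26ThermalCapRetiltMarkovBoxp1`; `6 log 2 + 38.7035·β`; flat word 42.3174).
ATOMIC DATA: Cu at `μ_d = −(εp + Δ_hi) = 579/100`, `U_d,hi = 5057/1000`; O at `μ_p = −εp = 9`, `U_p,hi = 2171/500` ⇒ classical slope 33.8390·β (family slope 34.1716; cap 38.7035).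
RESULT: **`emeryBoxYBCO65planeY6K26_pressureWindowHighT_m9`**: `max(atomic, family) ≤ P_cell ≤ 6 log 2 + 38.7035·β` on the whole box, every β ≥ 0; width → 0 as β → 0 (both sides `6 log 2`,
`emeryBoxYBCO65planeY6K26_pressure_beta_zero_m9`); crossover β* ≈ 1.321 (T* ≈ 8782 K) below which the atomic floor is the better floor [float].

Everything PROVED (0 sorry); no definition. HONEST FRAMING: CERTIFIED inequalities on a SCREENING/EXTRAPOLATED-grade object; the atomic floor ignores hopping (its slope sits
0.3326 below the family floor's), so at physical temperatures (β ≈ 20–40 eV⁻¹) the family floor still decides and thermal scales are NOT resolved there; what is new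
is the correct INFINITE-TEMPERATURE closure of the window and a certified high-T regime (β ≲ β*) with width `≈ 4.8645·β`; grand-canonical at the stated level; no phase word;
no router number moves. WHAT-THIS-IS-NOT: a new certificate (pure algebra on landed objects; zero kit).
-/

noncomputable section

namespace Summit.Ventures.CertifiedManyBodySolver.Downfold

open NonemptyInterval Matrix Finset Literature.Probability.LatticeModels
open Literature.MathematicalPhysics.QuantumLattice Literature.Computation.Certificates
open Summit.Ventures.CertifiedManyBodySolver.Certificates OccupationCode ClusterLowerBound
open scoped BigOperators ComplexOrder

/-! ## §1 The atomic-limit floor on the box at εp = -9 -/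

/-- **ATOMIC-LIMIT `T > 0` FLOOR** on the whole `emeryBoxYBCO65planeY6K26`, cuprate signs, level εp = -9 (chemical potential 9 eV), EVERY β ≥ 0:
`log z₀(β; U_d = 5057/1000, μ_d = 579/100) + 2·log z₀(β; U_p = 2171/500, μ_p = 9) ≤ P_cell` with `z₀(β; U, μ) = 1 + 2e^{βμ} + e^{−β(U−2μ)}` (`atomicPartitionFnReal`; Cu at the
box's upper level `εp + Δ_hi = -579/100` and `U_d,hi`, O at `εp` and `U_p,hi`). Value `6 log 2` at β = 0; slope `33.8390·β` as β → ∞ (classical minimum, no hopping).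
[cite: Ruelle1969, §2.5–2.6] [cite: Ueltschi1999, §3] -/
theorem emeryBoxYBCO65planeY6K26_pressureAtomicFloor_m9 {β : ℝ} (hβ : 0 ≤ β) :
    HoldsOn (fun p : EmeryCoord → ℝ => Real.log (atomicPartitionFnReal β (5057/1000 : ℝ) (579/100 : ℝ)) + 2 * Real.log (atomicPartitionFnReal β (2171/500 : ℝ) (9 : ℝ)) ≤ emeryCellPressure β (emeryLine cuprateSigns (emeryLineCoords (((-9 : ℚ)) : ℝ) p))) emeryBoxYBCO65planeY6K26 := by
  intro p hp
  have h := holdsOn_emeryCellPressureAtomicFloor (E := emeryBoxYBCO65planeY6K26) (eA := ybco65planeY6K26Emery_tpd) (eB := ybco65planeY6K26Emery_tpp) (eD := ybco65planeY6K26Emery_Delta) (eUd := ybco65planeY6K26Emery_Udd) (eUp := ybco65planeY6K26Emery_Upp) (-9) (by simp [emeryBoxYBCO65planeY6K26, emeryBoxYBCO65planeY6K26Src, Function.update]) (by simp [emeryBoxYBCO65planeY6K26, emeryBoxYBCO65planeY6K26Src, Function.update]) (Function.update_self _ _ _) (by simp [emeryBoxYBCO65planeY6K26, emeryBoxYBCO65planeY6K26Src,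 Function.update]) (by simp [emeryBoxYBCO65planeY6K26, emeryBoxYBCO65planeY6K26Src, Function.update]) cuprateSigns hβ p hp
  simp only [ybco65planeY6K26Emery_Delta, ybco65planeY6K26Emery_Udd, ybco65planeY6K26Emery_Upp, Entry.encl_ofEnds_snd] at h
  push_cast at h
  norm_num at h ⊢
  exact h

/-! ## §2 The best floor and the HIGH-TEMPERATURE-CLOSING window -/

/-- **BEST `T > 0` FLOOR = max(atomic, family)** on the whole box at εp = -9, every β ≥ 0: the atomic floor (full entropy, slope 33.8390) wins for
β < β* ≈ 1.321 (T > 8782 K), the family floor `emeryBoxYBCO65planeY6K26_pressureFloorFam_m9` (slope 34.1716, entropy ¼·log 2) for β > β*. [cite: Ruelle1969, §2.5–2.6] [cite: Israel1979, Lemma II.3.1] -/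
theorem emeryBoxYBCO65planeY6K26_pressureFloorBest_m9 {β : ℝ} (hβ : 0 ≤ β) :
    HoldsOn (fun p : EmeryCoord → ℝ => max (Real.log (atomicPartitionFnReal β (5057/1000 : ℝ) (579/100 : ℝ)) + 2 * Real.log (atomicPartitionFnReal β (2171/500 : ℝ) (9 : ℝ))) (Real.log (Real.exp (-(β * (-27285193/200000 : ℝ))) + Real.exp (-(β * (-34171591/250000 : ℝ)))) / 4) ≤ emeryCellPressure β (emeryLine cuprateSigns (emeryLineCoords (((-9 : ℚ)) : ℝ) p))) emeryBoxYBCO65planeY6K26 :=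
  fun p hp => max_le (emeryBoxYBCO65planeY6K26_pressureAtomicFloor_m9 hβ p hp) (emeryBoxYBCO65planeY6K26_pressureFloorFam_m9 hβ p hp)

/-- **THE HIGH-TEMPERATURE-CLOSING TWO-SIDED `T > 0` WINDOW** (hypothesis-free on both sides) on the whole `emeryBoxYBCO65planeY6K26`, level εp = -9, EVERY β ≥ 0:
`max(atomic, family) ≤ P_cell ≤ 6 log 2 + β·77407/2000` (cap = `emeryBoxYBCO65planeY6K26_pressureCap_m9_retilt`, hubbard-box-p1 re-tilted). BOTH SIDES EQUAL `6 log 2` AT β = 0; the width is `O(β)` for small β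
(slope gap 4.8645 against the atomic floor, 4.5319 against the family floor). Table [float; `T = 11604.5/β` K]:
| β (1/eV) | T (K) | atomic floor | family floor | best floor | cap | width |
|---|---|---|---|---|---|---|
| 0.01 | 1160450 | 4.3652 | 0.5147 | 4.3652 | 4.5459 | 0.1807 |
| 0.1 | 116045 | 6.4425 | 3.5872 | 6.4425 | 8.0292 | 1.5867 |
| 0.5 | 23209 | 18.1629 | 17.2433 | 18.1629 | 23.5106 | 5.3477 |
| 1 | 11604 | 34.5508 | 34.3144 | 34.5508 | 42.8624 | 8.3116 |
| 2 | 5802 | 68.0580 | 68.4598 | 68.4598 | 81.5659 | 13.1061 |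
| 5 | 2321 | 169.2449 | 170.9181 | 170.9181 | 197.6764 | 26.7583 |
| 10 | 1160 | 338.3913 | 341.7338 | 341.7338 | 391.1939 | 49.4601 |
| 20 | 580 | 676.7800 | 683.4332 | 683.4332 | 778.2289 | 94.7957 |
| 40 | 290 | 1353.5600 | 1366.8636 | 1366.8636 | 1552.2989 | 185.4352 |
[cite: Israel1979, Thm. I.2.4] [cite: Ruelle1969, §2.5–2.6] [cite: Ueltschi1999, §3] -/
theorem emeryBoxYBCO65planeY6K26_pressureWindowHighT_m9 {β : ℝ} (hβ : 0 ≤ β) :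
    HoldsOn (fun p : EmeryCoord → ℝ =>
      max (Real.log (atomicPartitionFnReal β (5057/1000 : ℝ) (579/100 : ℝ)) + 2 * Real.log (atomicPartitionFnReal β (2171/500 : ℝ) (9 : ℝ))) (Real.log (Real.exp (-(β * (-27285193/200000 : ℝ))) + Real.exp (-(β * (-34171591/250000 : ℝ)))) / 4) ≤ emeryCellPressure β (emeryLine cuprateSigns (emeryLineCoords (((-9 : ℚ)) : ℝ) p)) ∧
      emeryCellPressure β (emeryLine cuprateSigns (emeryLineCoords (((-9 : ℚ)) : ℝ) p)) ≤ 6 * Real.log 2 + β * (77407/2000 : ℝ)) emeryBoxYBCO65planeY6K26 :=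
  fun p hp => ⟨emeryBoxYBCO65planeY6K26_pressureFloorBest_m9 hβ p hp, by simpa using emeryBoxYBCO65planeY6K26_pressureCap_m9_retilt hβ p hp⟩

/-- **At β = 0 the window is a point**: `P_cell(0, ·) = 6 log 2` on the whole box (floor and cap coincide). [cite: Ueltschi1999, §3] -/
theorem emeryBoxYBCO65planeY6K26_pressure_beta_zero_m9 :
    HoldsOn (fun p : EmeryCoord → ℝ => emeryCellPressure 0 (emeryLine cuprateSigns (emeryLineCoords (((-9 : ℚ)) : ℝ) p)) = 6 * Real.log 2) emeryBoxYBCO65planeY6K26 := by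
  intro p hp
  have h := emeryBoxYBCO65planeY6K26_pressureWindowHighT_m9 le_rfl p hp
  rw [atomicPartitionFnReal_beta_zero, atomicPartitionFnReal_beta_zero, show (4 : ℝ) = 2 ^ 2 by norm_num, Real.log_pow] at h
  simp only [Nat.cast_ofNat, zero_mul, add_zero] at h
  have h1 := (le_max_left _ _).trans h.1
  linarith [h.2]

end Summit.Ventures.CertifiedManyBodySolver.Downfold

end
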